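import Summits.QuantumFields.YangMills.Theorems.ColdStartUniversalityLatticeLangevinHeatKernelLawAllTimes
import Summits.QuantumFields.YangMills.Theorems.ColdStartUniversalityLatticeLangevinHeatKernelLocalBound
import Literature.Computability.QuantumComplexity.SU2ChordGeometry
import HarnessLib

/-!
# Route `ColdStartUniversality` (fixed-cut-off package, `β' = 0`): the SU(2) heat kernel is a CONVOLUTION SEMIGROUP, and
# positivity SPREADS along square roots — `h_{2t}(U) > 0` as soon as `h_t(√U) > 0`

Helper file (seat `ym-line-csu-p1`, g12, free hands; third brick of the small-time Doeblin programme of the g10/g11 memos —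
bricks 1–2 are `…HeatKernelLawAllTimes` (`h_t ≥ 0`, the law identity for all `t > 0`) and `…HeatKernelLocalBound`
(`h_t(1) − h_t(U) ≤ (1 − Re tr U/2)·D_t`)).  For the character series
`h_t(U) = Σ (n+1) e^{-n(n+2)t/2} χ_n(U)` (written inline, as in the tree):

* `abs_heatKernelSU2_le_majorant` — `|h_t(U)| ≤ Σ (n+1)² e^{-n(n+2)t/2}`;
* ★ `heatKernelSU2_semigroup` — `∫ h_s(V) h_{s'}(V⁻¹U) dV = h_{s+s'}(U)` (Haar probability; term by term from the tree's
  character convolution identity `integral_su2Char_mul_heatKernelSU2`);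
* ★ `heatKernelSU2_add_pos_of_exists` — if `h_s(V₀) > 0` and `h_{s'}(V₀⁻¹ U) > 0` for ONE `V₀` then `h_{s+s'}(U) > 0`
  (continuity, `h ≥ 0`, Haar charges open sets);
* `exists_sqrt_su2` — every `U ∈ SU(2)` with `Re tr U > -2` has the explicit square root `w = (2 + tr U)^{-1/2}(1 + U)`
  with `(Re tr w/2)² = (1 + Re tr U/2)/2`, `Re tr w ≥ 0`; `exists_re_trace_zero` — for every `U` some `V` with `Re tr V = 0`
  and `Re tr(UV) ≥ 0` (`V = [[0,1],[-1,0]]` or its adjoint);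
* ★ `heatKernelSU2_pos_doubling` — if `h_t > 0` on `{1 − Re tr/2 < a}` then `h_{2t} > 0` on `{1 − Re tr/2 < 2a(2−a)}`;
  ★ `heatKernelSU2_pos_everywhere_of_one_lt` — if moreover `a > 1` then `h_{2t} > 0` EVERYWHERE;
  `heatKernelSU2_pos_mono` — positivity everywhere propagates to all later times;
  `heatKernelSU2_pos_near_one` — `h_t > 0` on `{(1 − Re tr/2)·D_t < h_t(1)}`.

The quantitative threshold `h_t(1)/D_t ≳ t` and the iteration closing `h_t > 0` for ALL `t > 0` are in the sequel
`…HeatKernelPositivity`.  THEOREMS ONLY, [folklore]; RECORD-rung R3 plumbing (towards the TP rung `FixedCutoffOverlap` for short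
windows); no crux, rung or summit is proved here; the Yang–Mills mass gap is NOT proved.
-/

set_option autoImplicit false

noncomputable section

namespace Summit.QuantumFields.YangMills.Theorems.ColdStartUniversality

open MeasureTheory Finset Filter
open scoped BigOperators Topology Matrix
open Literature.MathematicalPhysics.QuantumFieldTheory
open Literature.MathematicalPhysics.QuantumFieldTheory.Tomboulis2007 (su2Char)
open Literature.Analysis.SpecialFunctions (gegenbauerSum)
open Literature.Computability.QuantumComplexity (star_coe_eq_adjugate coe_add_star trace_coe_im
  adjugate_fin_two_eq_trace_smul_sub)

/-! ## The series is bounded by its majorant -/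

/-- `|h_t(U)| ≤ Σ (n+1)² e^{-n(n+2)t/2}`. [folklore] -/
theorem abs_heatKernelSU2_le_majorant {t : ℝ} (ht : 0 < t) (U : Matrix.specialUnitaryGroup (Fin 2) ℂ) :
    |∑' n : ℕ, ((n : ℝ) + 1) * Real.exp (-((n : ℝ) * ((n : ℝ) + 2) / 2) * t) * su2Char n U| ≤
      ∑' n : ℕ, ((n : ℝ) + 1) ^ 2 * Real.exp (-((n : ℝ) * ((n : ℝ) + 2) / 2) * t) := by
  have hs := summable_heatKernelSU2 ht U
  have h1 := norm_tsum_le_tsum_norm hs.norm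
  rw [Real.norm_eq_abs] at h1
  exact h1.trans (Summable.tsum_le_tsum (fun n => norm_heatKernelSU2_term_le t n U) hs.norm
    (summable_heatKernelSU2_majorant ht))

/-- The majorant sum is non-negative. [folklore] -/
theorem heatKernelSU2_majorant_nonneg (t : ℝ) :
    0 ≤ ∑' n : ℕ, ((n : ℝ) + 1) ^ 2 * Real.exp (-((n : ℝ) * ((n : ℝ) + 2) / 2) * t) :=
  tsum_nonneg fun n => by positivity

/-! ## The convolution semigroup identity -/

/-- `h` is invariant under `V⁻¹U ↦ VU⁻¹` term by term (class function, inversion invariant). [folklore] -/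
theorem heatKernelSU2_inv_mul_eq_mul_inv (t : ℝ) (U V : Matrix.specialUnitaryGroup (Fin 2) ℂ) :
    (∑' n : ℕ, ((n : ℝ) + 1) * Real.exp (-((n : ℝ) * ((n : ℝ) + 2) / 2) * t) * su2Char n (V⁻¹ * U)) =
      ∑' n : ℕ, ((n : ℝ) + 1) * Real.exp (-((n : ℝ) * ((n : ℝ) + 2) / 2) * t) * su2Char n (V * U⁻¹) := by
  refine tsum_congr fun n => ?_
  rw [← su2Char_inv n (V⁻¹ * U), mul_inv_rev, inv_inv, su2Char_mul_comm]

/-- ★ **The SU(2) heat kernel is a convolution semigroup**: `∫ h_s(V) h_{s'}(V⁻¹U) dV = h_{s+s'}(U)` for the Haar probability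
measure, `s, s' > 0`. [folklore] -/
theorem heatKernelSU2_semigroup {s s' : ℝ} (hs : 0 < s) (hs' : 0 < s') (U : Matrix.specialUnitaryGroup (Fin 2) ℂ) :
    ∫ V, (∑' n : ℕ, ((n : ℝ) + 1) * Real.exp (-((n : ℝ) * ((n : ℝ) + 2) / 2) * s) * su2Char n V) *
        (∑' n : ℕ, ((n : ℝ) + 1) * Real.exp (-((n : ℝ) * ((n : ℝ) + 2) / 2) * s') * su2Char n (V⁻¹ * U))
        ∂(haarProbability (Matrix.specialUnitaryGroup (Fin 2) ℂ)) =
      ∑' n : ℕ, ((n : ℝ) + 1) * Real.exp (-((n : ℝ) * ((n : ℝ) + 2) / 2) * (s + s')) * su2Char n U := by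
  haveI : IsProbabilityMeasure (haarProbability (Matrix.specialUnitaryGroup (Fin 2) ℂ)) := inferInstance
  simp_rw [heatKernelSU2_inv_mul_eq_mul_inv s' U]
  -- the second factor is a bounded continuous function of `V`
  set g : Matrix.specialUnitaryGroup (Fin 2) ℂ → ℝ := fun V =>
    ∑' n : ℕ, ((n : ℝ) + 1) * Real.exp (-((n : ℝ) * ((n : ℝ) + 2) / 2) * s') * su2Char n (V * U⁻¹) with hg
  set M : ℝ := ∑' n : ℕ, ((n : ℝ) + 1) ^ 2 * Real.exp (-((n : ℝ) * ((n : ℝ) + 2) / 2) * s') with hM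
  have hM0 : 0 ≤ M := heatKernelSU2_majorant_nonneg s'
  have hg_cont : Continuous g := (continuous_heatKernelSU2 hs').comp (continuous_mul_const U⁻¹)
  have hg_bound : ∀ V, |g V| ≤ M := fun V => abs_heatKernelSU2_le_majorant hs' (V * U⁻¹)
  -- pull `g` into the first series and exchange sum and integral
  simp_rw [← tsum_mul_right]
  have hterm_cont : ∀ n : ℕ, Continuous fun V : Matrix.specialUnitaryGroup (Fin 2) ℂ =>
      ((n : ℝ) + 1) * Real.exp (-((n : ℝ) * ((n : ℝ) + 2) / 2) * s) * su2Char n V * g V :=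
    fun n => (continuous_const.mul (continuous_su2Char_apply n)).mul hg_cont
  have hbound : ∀ (n : ℕ) (V : Matrix.specialUnitaryGroup (Fin 2) ℂ),
      ‖((n : ℝ) + 1) * Real.exp (-((n : ℝ) * ((n : ℝ) + 2) / 2) * s) * su2Char n V * g V‖ ≤
        ((n : ℝ) + 1) ^ 2 * Real.exp (-((n : ℝ) * ((n : ℝ) + 2) / 2) * s) * M := by
    intro n V
    rw [norm_mul]
    exact mul_le_mul (norm_heatKernelSU2_term_le s n V) ((Real.norm_eq_abs _).le.trans (hg_bound V))
      (norm_nonneg _) (by positivity)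
  have hint : ∀ n : ℕ, Integrable (fun V : Matrix.specialUnitaryGroup (Fin 2) ℂ =>
      ((n : ℝ) + 1) * Real.exp (-((n : ℝ) * ((n : ℝ) + 2) / 2) * s) * su2Char n V * g V)
      (haarProbability (Matrix.specialUnitaryGroup (Fin 2) ℂ)) := fun n =>
    Integrable.of_bound (hterm_cont n).measurable.aestronglyMeasurable _ (Eventually.of_forall (hbound n))
  rw [← integral_tsum_of_summable_integral_norm hint]
  · refine tsum_congr fun n => ?_
    have key : ∫ V, su2Char n V * g V ∂(haarProbability (Matrix.specialUnitaryGroup (Fin 2) ℂ)) =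
        Real.exp (-((n : ℝ) * ((n : ℝ) + 2) / 2) * s') * su2Char n U := by
      have h := integral_su2Char_mul_heatKernelSU2 hs' n 1 U
      simpa only [inv_one, mul_one] using h
    calc ∫ V, ((n : ℝ) + 1) * Real.exp (-((n : ℝ) * ((n : ℝ) + 2) / 2) * s) * su2Char n V * g V
          ∂(haarProbability (Matrix.specialUnitaryGroup (Fin 2) ℂ))
        = ((n : ℝ) + 1) * Real.exp (-((n : ℝ) * ((n : ℝ) + 2) / 2) * s) *
            ∫ V, su2Char n V * g V ∂(haarProbability (Matrix.specialUnitaryGroup (Fin 2) ℂ)) := by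
          rw [← integral_const_mul]
          exact integral_congr_ae (Eventually.of_forall fun V => by ring)
      _ = ((n : ℝ) + 1) * Real.exp (-((n : ℝ) * ((n : ℝ) + 2) / 2) * (s + s')) * su2Char n U := by
          have hexp : Real.exp (-((n : ℝ) * ((n : ℝ) + 2) / 2) * (s + s')) =
              Real.exp (-((n : ℝ) * ((n : ℝ) + 2) / 2) * s) * Real.exp (-((n : ℝ) * ((n : ℝ) + 2) / 2) * s') := by
            rw [← Real.exp_add]; congr 1; ring
          rw [key, hexp]; ring
  · refine Summable.of_nonneg_of_le (fun n => integral_nonneg fun V => norm_nonneg _) (fun n => ?_)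
      ((summable_heatKernelSU2_majorant hs).mul_right M)
    have h := integral_mono_of_nonneg (μ := haarProbability (Matrix.specialUnitaryGroup (Fin 2) ℂ))
      (Eventually.of_forall fun V => norm_nonneg _) (integrable_const _) (Eventually.of_forall (hbound n))
    simpa using h

/-! ## Positivity spreads through the semigroup identity -/

/-- ★ **Positivity from one point**: if `h_s(V₀) > 0` and `h_{s'}(V₀⁻¹ U) > 0` for some `V₀`, then `h_{s+s'}(U) > 0`
(the convolution integrand is continuous, non-negative and positive at `V₀`; Haar charges open sets). [folklore] -/
theorem heatKernelSU2_add_pos_of_exists {s s' : ℝ} (hs : 0 < s) (hs' : 0 < s')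
    (U V₀ : Matrix.specialUnitaryGroup (Fin 2) ℂ)
    (h1 : 0 < ∑' n : ℕ, ((n : ℝ) + 1) * Real.exp (-((n : ℝ) * ((n : ℝ) + 2) / 2) * s) * su2Char n V₀)
    (h2 : 0 < ∑' n : ℕ, ((n : ℝ) + 1) * Real.exp (-((n : ℝ) * ((n : ℝ) + 2) / 2) * s') * su2Char n (V₀⁻¹ * U)) :
    0 < ∑' n : ℕ, ((n : ℝ) + 1) * Real.exp (-((n : ℝ) * ((n : ℝ) + 2) / 2) * (s + s')) * su2Char n U := by
  haveI : IsProbabilityMeasure (haarProbability (Matrix.specialUnitaryGroup (Fin 2) ℂ)) := inferInstance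
  haveI := YM2.isOpenPosMeasure_haarProbability (Matrix.specialUnitaryGroup (Fin 2) ℂ)
  rw [← heatKernelSU2_semigroup hs hs' U]
  set f : Matrix.specialUnitaryGroup (Fin 2) ℂ → ℝ := fun V =>
    (∑' n : ℕ, ((n : ℝ) + 1) * Real.exp (-((n : ℝ) * ((n : ℝ) + 2) / 2) * s) * su2Char n V) *
      (∑' n : ℕ, ((n : ℝ) + 1) * Real.exp (-((n : ℝ) * ((n : ℝ) + 2) / 2) * s') * su2Char n (V⁻¹ * U)) with hf
  have hf_cont : Continuous f :=
    (continuous_heatKernelSU2 hs).mul ((continuous_heatKernelSU2 hs').comp (continuous_inv.mul continuous_const))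
  have hf_nn : 0 ≤ f := fun V => mul_nonneg (heatKernelSU2_nonneg hs V) (heatKernelSU2_nonneg hs' _)
  have hf_bound : ∀ V, ‖f V‖ ≤ (∑' n : ℕ, ((n : ℝ) + 1) ^ 2 * Real.exp (-((n : ℝ) * ((n : ℝ) + 2) / 2) * s)) *
      ∑' n : ℕ, ((n : ℝ) + 1) ^ 2 * Real.exp (-((n : ℝ) * ((n : ℝ) + 2) / 2) * s') := by
    intro V
    rw [hf, norm_mul, Real.norm_eq_abs, Real.norm_eq_abs]
    exact mul_le_mul (abs_heatKernelSU2_le_majorant hs V) (abs_heatKernelSU2_le_majorant hs' _) (abs_nonneg _)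
      (heatKernelSU2_majorant_nonneg s)
  have hfi : Integrable f (haarProbability (Matrix.specialUnitaryGroup (Fin 2) ℂ)) :=
    Integrable.of_bound hf_cont.measurable.aestronglyMeasurable _ (Eventually.of_forall hf_bound)
  have hV₀ : 0 < f V₀ := mul_pos h1 h2
  have hopen : IsOpen {V | 0 < f V} := isOpen_lt continuous_const hf_cont
  have hpos : 0 < haarProbability (Matrix.specialUnitaryGroup (Fin 2) ℂ) {V | 0 < f V} := hopen.measure_pos _ ⟨V₀, hV₀⟩
  have hsub : {V | 0 < f V} ⊆ Function.support f := fun V hV => (ne_of_gt hV : f V ≠ 0)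
  exact (integral_pos_iff_support_of_nonneg hf_nn hfi).2 (hpos.trans_le (measure_mono hsub))

/-- **Positivity everywhere propagates to all later times**: if `h_T > 0` on all of `SU(2)` then `h_t > 0` on all of
`SU(2)` for every `t ≥ T` (`h_t = h_T * h_{t-T}`, `h_{t-T}(1) > 0`). [folklore] -/
theorem heatKernelSU2_pos_mono {T t : ℝ} (hT : 0 < T) (hTt : T ≤ t)
    (hall : ∀ V : Matrix.specialUnitaryGroup (Fin 2) ℂ,
      0 < ∑' n : ℕ, ((n : ℝ) + 1) * Real.exp (-((n : ℝ) * ((n : ℝ) + 2) / 2) * T) * su2Char n V)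
    (U : Matrix.specialUnitaryGroup (Fin 2) ℂ) :
    0 < ∑' n : ℕ, ((n : ℝ) + 1) * Real.exp (-((n : ℝ) * ((n : ℝ) + 2) / 2) * t) * su2Char n U := by
  rcases eq_or_lt_of_le hTt with h | h
  · rw [← h]; exact hall U
  · have hs' : 0 < t - T := by linarith
    have heq : t = T + (t - T) := by ring
    rw [heq]
    refine heatKernelSU2_add_pos_of_exists hT hs' U U (hall U) ?_
    rw [inv_mul_cancel]
    exact heatKernelSU2_one_pos hs'

/-- **Local positivity near the identity**: `h_t(U) > 0` whenever `(1 − Re tr U/2) · D_t < h_t(1)`. [folklore] -/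
theorem heatKernelSU2_pos_near_one {t : ℝ} (ht : 0 < t) (U : Matrix.specialUnitaryGroup (Fin 2) ℂ)
    (hU : (1 - ((U : Matrix (Fin 2) (Fin 2) ℂ)).trace.re / 2) *
        (∑' n : ℕ, ((n : ℝ) + 1) * Real.exp (-((n : ℝ) * ((n : ℝ) + 2) / 2) * t) *
          ((n : ℝ) * ((n : ℝ) + 1) * ((n : ℝ) + 2) / 3)) <
      ∑' n : ℕ, ((n : ℝ) + 1) * Real.exp (-((n : ℝ) * ((n : ℝ) + 2) / 2) * t) *
        su2Char n (1 : Matrix.specialUnitaryGroup (Fin 2) ℂ)) :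
    0 < ∑' n : ℕ, ((n : ℝ) + 1) * Real.exp (-((n : ℝ) * ((n : ℝ) + 2) / 2) * t) * su2Char n U := by
  have h := heatKernelSU2_one_sub_le ht U
  linarith

/-! ## Square roots and quarter turns in `SU(2)` -/

/-- `Re tr(V⁻¹) = Re tr V` on `SU(2)`. [folklore] -/
theorem re_trace_inv (V : Matrix.specialUnitaryGroup (Fin 2) ℂ) :
    ((V⁻¹ : Matrix.specialUnitaryGroup (Fin 2) ℂ) : Matrix (Fin 2) (Fin 2) ℂ).trace.re =
      ((V : Matrix (Fin 2) (Fin 2) ℂ)).trace.re := by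
  have h : ((V⁻¹ : Matrix.specialUnitaryGroup (Fin 2) ℂ) : Matrix (Fin 2) (Fin 2) ℂ) = star (V : Matrix (Fin 2) (Fin 2) ℂ) :=
    rfl
  rw [h, Matrix.star_eq_conjTranspose, Matrix.trace_conjTranspose, Complex.star_def, Complex.conj_re]

/-- `|Re tr U / 2| ≤ 1`, lower half: `-1 ≤ Re tr U/2`; upper half `Re tr U/2 ≤ 1`. [folklore] -/
theorem re_trace_div_two_mem (U : Matrix.specialUnitaryGroup (Fin 2) ℂ) :
    -1 ≤ ((U : Matrix (Fin 2) (Fin 2) ℂ)).trace.re / 2 ∧ ((U : Matrix (Fin 2) (Fin 2) ℂ)).trace.re / 2 ≤ 1 :=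
  abs_le.1 (abs_re_trace_div_two_le U)

/-- **Explicit square roots in `SU(2)`**: if `Re tr U > -2` then `w = (2 + tr U)^{-1/2} (1 + U) ∈ SU(2)` satisfies `w² = U`,
`(Re tr w / 2)² = (1 + Re tr U / 2)/2` and `Re tr w ≥ 0` (Cayley–Hamilton `U² = tr U · U − 1`, `U + U† = tr U · 1`). [folklore] -/
theorem exists_sqrt_su2 (U : Matrix.specialUnitaryGroup (Fin 2) ℂ) (hU : -1 < ((U : Matrix (Fin 2) (Fin 2) ℂ)).trace.re / 2) :
    ∃ w : Matrix.specialUnitaryGroup (Fin 2) ℂ, w * w = U ∧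
      (((w : Matrix (Fin 2) (Fin 2) ℂ)).trace.re / 2) ^ 2 = (1 + ((U : Matrix (Fin 2) (Fin 2) ℂ)).trace.re / 2) / 2 ∧
      0 ≤ ((w : Matrix (Fin 2) (Fin 2) ℂ)).trace.re / 2 := by
  set A : Matrix (Fin 2) (Fin 2) ℂ := (U : Matrix (Fin 2) (Fin 2) ℂ) with hA
  have hmem := Matrix.mem_specialUnitaryGroup_iff.1 U.2
  have hAu : A * star A = 1 := Matrix.mem_unitaryGroup_iff.1 hmem.1
  have hdet : A.det = 1 := hmem.2
  set T : ℂ := A.trace with hT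
  have hTim : T.im = 0 := trace_coe_im U
  have hTre : T = ((T.re : ℝ) : ℂ) := Complex.ext (by simp) (by simp [hTim])
  have hx : -2 < T.re := by rw [hT, hA]; linarith
  set r : ℝ := Real.sqrt (2 + T.re) with hr
  have hr0 : 0 < r := Real.sqrt_pos.2 (by linarith)
  have hr2 : r ^ 2 = 2 + T.re := Real.sq_sqrt (by linarith)
  have hrC : (r : ℂ) ≠ 0 := by exact_mod_cast hr0.ne'
  -- the scalar identity `r⁻² (2 + T) = 1`
  have hsc : ((r : ℂ)⁻¹ * (r : ℂ)⁻¹) * (2 + T) = 1 := by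
    rw [hTre]
    have h2T : ((2 : ℂ) + ((T.re : ℝ) : ℂ)) = (((2 + T.re : ℝ)) : ℂ) := by push_cast; ring
    rw [h2T, ← hr2]
    push_cast
    field_simp
  -- structure identities of `SU(2)`
  have hadd : A + star A = T • (1 : Matrix (Fin 2) (Fin 2) ℂ) := coe_add_star U
  have hsq : A * A = T • A - 1 := by
    have hCH : A * Matrix.adjugate A = A.det • (1 : Matrix (Fin 2) (Fin 2) ℂ) := Matrix.mul_adjugate A
    rw [hdet, one_smul, adjugate_fin_two_eq_trace_smul_sub, mul_sub, Matrix.mul_smul, mul_one] at hCH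
    rw [← hCH]; abel
  -- the candidate
  set M : Matrix (Fin 2) (Fin 2) ℂ := ((r : ℂ)⁻¹) • (1 + A) with hM
  have hprod : (1 + A) * (1 + star A) = (2 + T) • (1 : Matrix (Fin 2) (Fin 2) ℂ) := by
    rw [mul_add, add_mul, add_mul, one_mul, mul_one, one_mul, hAu]
    calc 1 + A + (star A + 1) = (1 + 1) + (A + star A) := by abel
      _ = (2 : ℂ) • (1 : Matrix (Fin 2) (Fin 2) ℂ) + T • 1 := by rw [hadd, two_smul]
      _ = (2 + T) • (1 : Matrix (Fin 2) (Fin 2) ℂ) := by rw [add_smul]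
  have hMu : M * star M = 1 := by
    have hstar : star M = ((r : ℂ)⁻¹) • (1 + star A) := by
      rw [hM, star_smul, star_add, star_one]
      congr 1
      rw [Complex.star_def, map_inv₀, Complex.conj_ofReal]
    rw [hstar, hM, Matrix.smul_mul, Matrix.mul_smul, smul_smul, hprod, smul_smul, hsc, one_smul]
  have hMdet : M.det = 1 := by
    rw [hM, Matrix.det_smul, Fintype.card_fin]
    have h1A : (1 + A).det = 2 + T := by
      rw [Matrix.det_fin_two]
      rw [Matrix.det_fin_two] at hdet
      rw [hT, Matrix.trace_fin_two]
      simp only [Matrix.add_apply, Matrix.one_apply_eq, Matrix.one_apply_ne (by decide : (0 : Fin 2) ≠ 1),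
        Matrix.one_apply_ne (by decide : (1 : Fin 2) ≠ 0), zero_add]
      linear_combination hdet
    rw [h1A, pow_two, hsc]
  have hMmem : M ∈ Matrix.specialUnitaryGroup (Fin 2) ℂ :=
    Matrix.mem_specialUnitaryGroup_iff.2 ⟨Matrix.mem_unitaryGroup_iff.2 hMu, hMdet⟩
  refine ⟨⟨M, hMmem⟩, Subtype.ext ?_, ?_, ?_⟩
  · -- `M² = U`
    show M * M = A
    have h11 : (1 + A) * (1 + A) = (2 + T) • A := by
      rw [mul_add, add_mul, add_mul, one_mul, mul_one, one_mul, hsq, add_smul, two_smul]; abel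
    rw [hM, Matrix.smul_mul, Matrix.mul_smul, smul_smul, h11, smul_smul, hsc, one_smul]
  · -- the half-angle identity
    have htrM : (M.trace).re / 2 = r / 2 := by
      rw [hM, Matrix.trace_smul, Matrix.trace_add, Matrix.trace_one, Fintype.card_fin, smul_eq_mul, ← hT, hTre]
      have : ((r : ℂ)⁻¹ * ((2 : ℕ) + ((T.re : ℝ) : ℂ))) = (((r⁻¹ * (2 + T.re) : ℝ)) : ℂ) := by push_cast; ring
      rw [this, Complex.ofReal_re, ← hr2]
      field_simp
    show ((M.trace).re / 2) ^ 2 = (1 + A.trace.re / 2) / 2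
    rw [htrM, ← hT]
    nlinarith [hr2]
  · show 0 ≤ (M.trace).re / 2
    have htrM : (M.trace).re = r⁻¹ * (2 + T.re) := by
      rw [hM, Matrix.trace_smul, Matrix.trace_add, Matrix.trace_one, Fintype.card_fin, smul_eq_mul, ← hT, hTre]
      have : ((r : ℂ)⁻¹ * ((2 : ℕ) + ((T.re : ℝ) : ℂ))) = (((r⁻¹ * (2 + T.re) : ℝ)) : ℂ) := by push_cast; ring
      rw [this, Complex.ofReal_re, Complex.ofReal_re]
    rw [htrM]
    have h2 : 0 ≤ 2 + T.re := by linarith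
    exact div_nonneg (mul_nonneg (inv_nonneg.2 hr0.le) h2) zero_le_two

/-- **Quarter turns**: for every `U ∈ SU(2)` there is `V ∈ SU(2)` with `Re tr V = 0` and `Re tr (U V) ≥ 0` (one of
`[[0,1],[-1,0]]`, `[[0,-1],[1,0]]`). [folklore] -/
theorem exists_re_trace_zero (U : Matrix.specialUnitaryGroup (Fin 2) ℂ) :
    ∃ V : Matrix.specialUnitaryGroup (Fin 2) ℂ, ((V : Matrix (Fin 2) (Fin 2) ℂ)).trace.re = 0 ∧
      0 ≤ (((U * V : Matrix.specialUnitaryGroup (Fin 2) ℂ)) : Matrix (Fin 2) (Fin 2) ℂ).trace.re := by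
  set J : Matrix (Fin 2) (Fin 2) ℂ := !![0, 1; -1, 0] with hJ
  set J' : Matrix (Fin 2) (Fin 2) ℂ := !![0, -1; 1, 0] with hJ'
  have hJstar : star J = J' := by
    rw [hJ, hJ', Matrix.star_eq_conjTranspose]
    ext i j
    fin_cases i <;> fin_cases j <;> simp [Matrix.conjTranspose_apply]
  have hJ'star : star J' = J := by
    rw [← hJstar, star_star]
  have hJJ' : J * J' = 1 := by
    rw [hJ, hJ']
    ext i j
    fin_cases i <;> fin_cases j <;> simp [Matrix.mul_apply, Fin.sum_univ_two]
  have hJ'J : J' * J = 1 := by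
    rw [hJ, hJ']
    ext i j
    fin_cases i <;> fin_cases j <;> simp [Matrix.mul_apply, Fin.sum_univ_two]
  have hJdet : J.det = 1 := by rw [hJ, Matrix.det_fin_two_of]; ring
  have hJ'det : J'.det = 1 := by rw [hJ', Matrix.det_fin_two_of]; ring
  have hJmem : J ∈ Matrix.specialUnitaryGroup (Fin 2) ℂ :=
    Matrix.mem_specialUnitaryGroup_iff.2 ⟨Matrix.mem_unitaryGroup_iff.2 (by rw [hJstar, hJJ']), hJdet⟩
  have hJ'mem : J' ∈ Matrix.specialUnitaryGroup (Fin 2) ℂ :=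
    Matrix.mem_specialUnitaryGroup_iff.2 ⟨Matrix.mem_unitaryGroup_iff.2 (by rw [hJ'star, hJ'J]), hJ'det⟩
  set A : Matrix (Fin 2) (Fin 2) ℂ := (U : Matrix (Fin 2) (Fin 2) ℂ) with hA
  have htrJ : (A * J).trace = -A 0 1 + A 1 0 := by
    rw [hJ, Matrix.trace_fin_two]
    simp [Matrix.mul_apply, Fin.sum_univ_two]
  have htrJ' : (A * J').trace = A 0 1 - A 1 0 := by
    rw [hJ', Matrix.trace_fin_two]
    simp [Matrix.mul_apply, Fin.sum_univ_two]
    ring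
  have hJ0 : J.trace.re = 0 := by rw [hJ, Matrix.trace_fin_two]; simp
  have hJ'0 : J'.trace.re = 0 := by rw [hJ', Matrix.trace_fin_two]; simp
  rcases le_or_gt 0 ((A * J).trace.re) with h | h
  · exact ⟨⟨J, hJmem⟩, hJ0, h⟩
  · refine ⟨⟨J', hJ'mem⟩, hJ'0, ?_⟩
    show 0 ≤ (A * J').trace.re
    rw [htrJ']
    rw [htrJ] at h
    simp only [Complex.add_re, Complex.neg_re, Complex.sub_re] at h ⊢
    linarith

/-! ## The doubling step and the final step -/

/-- ★ **Doubling**: if `h_t > 0` on `{V : 1 − Re tr V/2 < a}` then `h_{2t} > 0` on `{U : 1 − Re tr U/2 < 2a(2 − a)}` —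
take `V₀ = √U`: `1 − Re tr U/2 = 2b(2 − b)` with `b = 1 − Re tr √U/2 ∈ [0, 1]`, so `b < a`. [folklore] -/
theorem heatKernelSU2_pos_doubling {t a : ℝ} (ht : 0 < t)
    (hPos : ∀ V : Matrix.specialUnitaryGroup (Fin 2) ℂ, 1 - ((V : Matrix (Fin 2) (Fin 2) ℂ)).trace.re / 2 < a →
      0 < ∑' n : ℕ, ((n : ℝ) + 1) * Real.exp (-((n : ℝ) * ((n : ℝ) + 2) / 2) * t) * su2Char n V)
    (U : Matrix.specialUnitaryGroup (Fin 2) ℂ) (hU : 1 - ((U : Matrix (Fin 2) (Fin 2) ℂ)).trace.re / 2 < 2 * a * (2 - a)) :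
    0 < ∑' n : ℕ, ((n : ℝ) + 1) * Real.exp (-((n : ℝ) * ((n : ℝ) + 2) / 2) * (t + t)) * su2Char n U := by
  have h2a : 2 * a * (2 - a) ≤ 2 := by nlinarith [sq_nonneg (a - 1)]
  have hxU : -1 < ((U : Matrix (Fin 2) (Fin 2) ℂ)).trace.re / 2 := by linarith
  obtain ⟨w, hw, hsq, hnn⟩ := exists_sqrt_su2 U hxU
  have hw1 := (re_trace_div_two_mem w).2
  set b : ℝ := 1 - ((w : Matrix (Fin 2) (Fin 2) ℂ)).trace.re / 2 with hb
  have hb0 : 0 ≤ b := by rw [hb]; linarith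
  have hb1 : b ≤ 1 := by rw [hb]; linarith
  have hUb : 1 - ((U : Matrix (Fin 2) (Fin 2) ℂ)).trace.re / 2 = 2 * b * (2 - b) := by
    rw [hb]; nlinarith [hsq]
  have hba : b < a := by
    by_contra h
    rw [not_lt] at h
    rcases le_or_gt a 1 with ha1 | ha1
    · have : 2 * a * (2 - a) ≤ 2 * b * (2 - b) := by nlinarith [mul_nonneg (sub_nonneg.2 h) (by linarith : 0 ≤ 2 - a - b)]
      linarith
    · linarith
  have h1 : 0 < ∑' n : ℕ, ((n : ℝ) + 1) * Real.exp (-((n : ℝ) * ((n : ℝ) + 2) / 2) * t) * su2Char n w := hPos w (by rw [← hb]; exact hba)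
  refine heatKernelSU2_add_pos_of_exists ht ht U w h1 ?_
  rw [← hw, inv_mul_cancel_left]
  exact h1

/-- ★ **Final step**: if `h_t > 0` on `{V : 1 − Re tr V/2 < a}` with `a > 1`, then `h_{2t} > 0` EVERYWHERE — take
`V₀ = U J^{±1}` with `J` a quarter turn: `Re tr V₀ ≥ 0`, `Re tr(V₀⁻¹ U) = Re tr J = 0`. [folklore] -/
theorem heatKernelSU2_pos_everywhere_of_one_lt {t a : ℝ} (ht : 0 < t) (ha : 1 < a)
    (hPos : ∀ V : Matrix.specialUnitaryGroup (Fin 2) ℂ, 1 - ((V : Matrix (Fin 2) (Fin 2) ℂ)).trace.re / 2 < a →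
      0 < ∑' n : ℕ, ((n : ℝ) + 1) * Real.exp (-((n : ℝ) * ((n : ℝ) + 2) / 2) * t) * su2Char n V)
    (U : Matrix.specialUnitaryGroup (Fin 2) ℂ) :
    0 < ∑' n : ℕ, ((n : ℝ) + 1) * Real.exp (-((n : ℝ) * ((n : ℝ) + 2) / 2) * (t + t)) * su2Char n U := by
  obtain ⟨V, hV0, hUV⟩ := exists_re_trace_zero U
  have h1 : 0 < ∑' n : ℕ, ((n : ℝ) + 1) * Real.exp (-((n : ℝ) * ((n : ℝ) + 2) / 2) * t) * su2Char n (U * V) :=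
    hPos (U * V) (by linarith)
  refine heatKernelSU2_add_pos_of_exists ht ht U (U * V) h1 ?_
  rw [mul_inv_rev, inv_mul_cancel_right]
  refine hPos V⁻¹ ?_
  rw [re_trace_inv, hV0]
  linarith

end Summit.QuantumFields.YangMills.Theorems.ColdStartUniversality

end
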